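import Summits.ResolutionOfSingularities.ResolutionOfSingularities.Theorems.FrobeniusLadderFRationalResolutionDescendedPrimaryPiece
import Summits.ResolutionOfSingularities.ResolutionOfSingularities.Theorems.FrobeniusLadderFRationalResolutionTrivialResiduePoint
import Summits.ResolutionOfSingularities.ResolutionOfSingularities.Theorems.FrobeniusLadderFRationalResolutionBlowupTensorAscent
import Mathlib.RingTheory.Unramified.LocalRing
import Mathlib.RingTheory.Unramified.Locus
import HarnessLib

/-!
# Crux `FrobeniusLadder.FRationalResolution` (stmt-ResolutionOfSingularities-15317), line `redirect`,
# stub `stub_diagonalizableQuotientResolution` — the UPSTAIRS PIECE of the Galois route, assembled: from an étale chart with a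
# `𝔔`-primary centre of regular blow-up, a smooth base change `B → B'` (e.g. `B' = B ⊗_K K'`) and an EMBEDDING of residue fields
# `κ(𝔔) ↪ κ(𝔔')`, a `𝔔'`-primary piece of `B'` with locally regular blow-up

Composition of `…FibreReduced` (twice), `…BlowupSmoothAscent.isMaximal_map_away`, `…TrivialResiduePoint`, Mathlib's unramified-at-a-prime
criterion, `…BlowupTensorAscent`, `…DescendedPrimaryPiece`, and the pull-back from the basic open `D(h₀) ⊆ Spec B'` where
`𝔔' B'_{h₀} = 𝔭 B'_{h₀}`. Output = the inputs `(I, n, g)` of `…GaloisBaseChangeRegular.hloc_of_decomposition_stable_piece'`, EXCEPT the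
decomposition-stability `hD` (the wall; memo MEMO-15317-leafhand4-g7 §3).

* **`exists_piece_of_residue_embedding`** — THE THEOREM of this file.

Honest label: plumbing/assembly (no stub closed by name). No definitions, no named facts, no sorry.
[cite: StacksProject, Tag 00UW; Tag 02NS] [cite: GortzWedhorn2020, Prop. 13.91 (2)] [cite: Grothendieck1967, Prop. 17.5.8 (iii)]
-/

noncomputable section

-- single-problem summit: the doubled namespace component is forced
set_option linter.dupNamespace false

open CategoryTheory AlgebraicGeometry TopologicalSpace TensorProduct
open Literature.AlgebraicGeometry.Resolution
open Summit.ResolutionOfSingularities.ResolutionOfSingularities.Theorems.FRationalResolution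

namespace Summit.ResolutionOfSingularities.ResolutionOfSingularities.Theorems.FRationalResolution.GaloisUpstairsPiece

/-- Unramified at a maximal ideal: `𝔭 C_𝔔 = 𝔔 C_𝔔` for a formally unramified `B → C` of finite type and `𝔔` over `𝔭`.
[cite: StacksProject, Tag 02G8] -/
theorem map_eq_maximalIdeal_of_formallyUnramified {B C : Type} [CommRing B] [CommRing C] [Algebra B C]
    [Algebra.FiniteType B C] [Algebra.FormallyUnramified B C] (𝔭 : Ideal B) [𝔭.IsPrime] (𝔔 : Ideal C) [𝔔.IsPrime]
    (h𝔔 : 𝔔.comap (algebraMap B C) = 𝔭) :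
    𝔭.map (algebraMap B (Localization.AtPrime 𝔔)) = IsLocalRing.maximalIdeal (Localization.AtPrime 𝔔) := by
  haveI : 𝔔.LiesOver 𝔭 := ⟨h𝔔.symm⟩
  letI := Localization.AtPrime.algebraOfLiesOver 𝔭 𝔔
  haveI : Algebra.IsUnramifiedAt B 𝔔 := (Algebra.formallyUnramified_iff_forall).mp inferInstance ⟨𝔔, inferInstance⟩
  exact ((Algebra.isUnramifiedAt_iff_map_eq B 𝔭 𝔔).mp inferInstance).2

/-- **THE UPSTAIRS PIECE from an embedding of residue fields.** `B` Noetherian, `C` a flat, finitely presented, formally unramified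
`B`-algebra (an étale chart), `𝔭 ⊆ B` and `𝔔 ⊆ C` maximal with `𝔔 ∩ B = 𝔭`, `J ⊆ C` with `𝔔ⁿ ⊆ J ⊆ 𝔔` and `Bl_J(Spec C)` regular;
`B → B'` with `B'` Noetherian and `Spec B' → Spec B` smooth, `𝔔' ⊆ B'` maximal over `𝔭` with `𝔭 B'_{𝔔'} = 𝔔' B'_{𝔔'}` (e.g. `B' = B ⊗_K K'`,
`K'/K` finite separable); and a ring map `ι : C/𝔔 → B'/𝔔'` compatible with `B` (an embedding of residue fields). Then there are an ideal
`I ⊆ B'` with `𝔔'ⁿ ⊆ I ⊆ 𝔔'` and `h ∉ 𝔔'` with `Bl_{I B'_h}(Spec B'_h)` regular.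
[cite: StacksProject, Tag 00UW; Tag 02NS] [cite: GortzWedhorn2020, Prop. 13.91 (2)] -/
theorem exists_piece_of_residue_embedding {B C B' : Type} [CommRing B] [CommRing C] [CommRing B'] [Algebra B C] [Algebra B B']
    [IsNoetherianRing B] [IsNoetherianRing B'] [Module.Flat B C] [Algebra.FinitePresentation B C] [Algebra.FormallyUnramified B C]
    [Smooth (Spec.map (CommRingCat.ofHom (algebraMap B B')))]
    (𝔭 : Ideal B) [𝔭.IsMaximal] (𝔔 : Ideal C) [h𝔔 : 𝔔.IsMaximal] (h𝔔𝔭 : 𝔔.comap (algebraMap B C) = 𝔭)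
    (J : Ideal C) {n : ℕ} (hJ : 𝔔 ^ n ≤ J) (hJ𝔔 : J ≤ 𝔔) (hregJ : Scheme.IsRegular (affineBlowup J))
    (𝔔' : Ideal B') [h𝔔' : 𝔔'.IsMaximal] (h𝔔'𝔭 : 𝔔'.comap (algebraMap B B') = 𝔭)
    (hred : 𝔭.map (algebraMap B (Localization.AtPrime 𝔔')) = IsLocalRing.maximalIdeal (Localization.AtPrime 𝔔'))
    (ι : C ⧸ 𝔔 →+* B' ⧸ 𝔔')
    (hι : ∀ b : B, ι (Ideal.Quotient.mk 𝔔 (algebraMap B C b)) = Ideal.Quotient.mk 𝔔' (algebraMap B B' b)) :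
    ∃ I : Ideal B', 𝔔' ^ n ≤ I ∧ I ≤ 𝔔' ∧
      ∃ h : B', h ∉ 𝔔' ∧ Scheme.IsRegular (affineBlowup (I.map (algebraMap B' (Localization.Away h)))) := by
  classical
  haveI : Algebra.FiniteType B C := inferInstance
  haveI : IsNoetherianRing C := Algebra.FiniteType.isNoetherianRing B C
  -- (1) shrink `B'` so that `𝔔'` is the reduced fibre of `𝔭`
  obtain ⟨h₀, hh₀, hle₀⟩ := FibreReduced.exists_away_fibre_reduced 𝔭 𝔔' hred
  set B'' := Localization.Away h₀ with hB''
  haveI : IsNoetherianRing B'' := IsLocalization.isNoetherianRing (Submonoid.powers h₀) B'' inferInstance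
  set 𝔔'' : Ideal B'' := 𝔔'.map (algebraMap B' B'') with h𝔔''
  haveI h𝔔''max : 𝔔''.IsMaximal := BlowupSmoothAscent.isMaximal_map_away 𝔔' hh₀ B''
  have hdisj₀ : Disjoint ((Submonoid.powers h₀ : Submonoid B') : Set B') (𝔔' : Set B') := by
    refine Set.disjoint_left.mpr ?_
    rintro x ⟨m, rfl⟩ hx
    exact hh₀ (h𝔔'.isPrime.mem_of_pow_mem m hx)
  have h𝔔''c : 𝔔''.comap (algebraMap B' B'') = 𝔔' :=
    IsLocalization.under_map_of_isPrime_disjoint (Submonoid.powers h₀) B'' h𝔔'.isPrime hdisj₀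
  have halgB'' : algebraMap B B'' = (algebraMap B' B'').comp (algebraMap B B') := IsScalarTower.algebraMap_eq B B' B''
  have h𝔔''𝔭 : 𝔔''.comap (algebraMap B B'') = 𝔭 := by
    rw [halgB'', ← Ideal.comap_comap, h𝔔''c, h𝔔'𝔭]
  have h𝔔''eq : 𝔔'' = 𝔭.map (algebraMap B B'') := by
    refine le_antisymm (by rw [halgB'']; exact hle₀) ?_
    rw [Ideal.map_le_iff_le_comap, h𝔔''𝔭]
  -- (2) the residue embedding, pushed to `B''`
  let ι'' : C ⧸ 𝔔 →+* B'' ⧸ 𝔔'' :=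
    (Ideal.quotientMap 𝔔'' (algebraMap B' B'') Ideal.le_comap_map).comp ι
  have hι'' : ∀ b : B, ι'' (Ideal.Quotient.mk 𝔔 (algebraMap B C b)) = Ideal.Quotient.mk 𝔔'' (algebraMap B B'' b) := by
    intro b
    simp only [ι'', RingHom.coe_comp, Function.comp_apply, hι b, Ideal.quotientMap_mk]
    rw [halgB'', RingHom.comp_apply]
  -- (3) the base-changed chart and its trivial-residue point
  set C'' := B'' ⊗[B] C with hC''
  haveI : Algebra.FiniteType B'' C'' := inferInstance
  haveI : IsNoetherianRing C'' := Algebra.FiniteType.isNoetherianRing B'' C''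
  obtain ⟨𝔚, h𝔚max, h𝔚B, h𝔚C, hres⟩ :=
    TrivialResiduePoint.exists_trivial_residue_point (B := B) (B' := B'') (C := C) 𝔔 𝔔'' ι'' hι''
  haveI := h𝔚max
  have hunr : 𝔔''.map (algebraMap B'' (Localization.AtPrime 𝔚)) = IsLocalRing.maximalIdeal _ :=
    map_eq_maximalIdeal_of_formallyUnramified 𝔔'' 𝔚 h𝔚B
  -- (4) shrink `C''` so that `𝔚` is the reduced fibre of `𝔔''`
  obtain ⟨g, hg, hleg⟩ := FibreReduced.exists_away_fibre_reduced 𝔔'' 𝔚 hunr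
  set C''' := Localization.Away g with hC'''
  haveI : Algebra.FinitePresentation B'' C''' :=
    haveI := IsLocalization.Away.finitePresentation g (S := C''')
    Algebra.FinitePresentation.trans B'' C'' C'''
  haveI : Algebra.FiniteType B'' C''' := inferInstance
  haveI : Algebra.FormallyUnramified C'' C''' := Algebra.FormallyUnramified.of_isLocalization (Submonoid.powers g)
  haveI : Algebra.FormallyUnramified B'' C''' := Algebra.FormallyUnramified.comp B'' C'' C'''
  set 𝔚' : Ideal C''' := 𝔚.map (algebraMap C'' C''') with h𝔚'
  haveI h𝔚'max : 𝔚'.IsMaximal := BlowupSmoothAscent.isMaximal_map_away 𝔚 hg C'''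
  have hdisjg : Disjoint ((Submonoid.powers g : Submonoid C'') : Set C'') (𝔚 : Set C'') := by
    refine Set.disjoint_left.mpr ?_
    rintro x ⟨m, rfl⟩ hx
    exact hg (h𝔚max.isPrime.mem_of_pow_mem m hx)
  have h𝔚'c : 𝔚'.comap (algebraMap C'' C''') = 𝔚 :=
    IsLocalization.under_map_of_isPrime_disjoint (Submonoid.powers g) C''' h𝔚max.isPrime hdisjg
  have halgC''' : algebraMap B'' C''' = (algebraMap C'' C''').comp (algebraMap B'' C'') :=
    IsScalarTower.algebraMap_eq B'' C'' C'''
  have h𝔚'B : 𝔚'.comap (algebraMap B'' C''') = 𝔔'' := by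
    rw [halgC''', ← Ideal.comap_comap, h𝔚'c, h𝔚B]
  have hover' : 𝔔'' ≤ 𝔚'.comap (algebraMap B'' C''') := h𝔚'B.ge
  have hres' : ∀ x : C''', ∃ b : B'', x - algebraMap B'' C''' b ∈ 𝔚' := by
    intro x
    obtain ⟨b, hb⟩ := CentreDescent.residual_surjective_away 𝔚 hres g hg C''' x
    exact ⟨b, by rw [halgC''', RingHom.comp_apply]; exact hb⟩
  have hunr' : 𝔔''.map (algebraMap B'' (Localization.AtPrime 𝔚')) = IsLocalRing.maximalIdeal _ :=
    map_eq_maximalIdeal_of_formallyUnramified 𝔔'' 𝔚' h𝔚'B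
  -- (5) the centre upstairs: `J C'''`
  let jC : C →+* C''' := (algebraMap C'' C''').comp
    ((Algebra.TensorProduct.includeRight : C →ₐ[B] C'') : C →+* C'')
  have hjB : jC.comp (algebraMap B C) = algebraMap B C''' := by
    ext b
    simp only [jC, RingHom.coe_comp, Function.comp_apply, RingHom.coe_coe]
    rw [IsScalarTower.algebraMap_apply B B'' C''', IsScalarTower.algebraMap_apply B'' C'' C''']
    congr 1
    rw [Algebra.TensorProduct.includeRight_apply, Algebra.TensorProduct.algebraMap_apply,
      IsScalarTower.algebraMap_apply B B'' B'' , Algebra.algebraMap_self, RingHom.id_apply]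
    exact (Algebra.TensorProduct.tmul_one_eq_one_tmul _).symm
  set J' : Ideal C''' := J.map jC with hJ'
  have hJ'𝔚 : J' ≤ 𝔚' := by
    have h1 : J.map ((Algebra.TensorProduct.includeRight : C →ₐ[B] C'') : C →+* C'') ≤ 𝔚 := by
      rw [Ideal.map_le_iff_le_comap, h𝔚C]; exact hJ𝔔
    rw [hJ', show jC = (algebraMap C'' C''').comp _ from rfl, ← Ideal.map_map]
    exact Ideal.map_mono h1
  have h𝔚'J : 𝔚' ^ n ≤ J' := by
    -- `𝔚' ≤ 𝔔'' C''' = 𝔭 C'''` and `𝔭ⁿ C''' ≤ 𝔔ⁿ C''' ≤ J C'''`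
    have h1 : 𝔚' ≤ 𝔭.map (algebraMap B C''') := by
      refine hleg.trans (le_of_eq ?_)
      rw [h𝔔''eq, Ideal.map_map, ← halgC''', ← IsScalarTower.algebraMap_eq B B'' C''']
    have h2 : 𝔭.map (algebraMap B C) ≤ 𝔔 := by rw [Ideal.map_le_iff_le_comap, h𝔔𝔭]
    calc 𝔚' ^ n ≤ (𝔭.map (algebraMap B C''')) ^ n := Ideal.pow_right_mono h1 n
      _ = ((𝔭.map (algebraMap B C)) ^ n).map jC := by
          rw [← Ideal.map_pow (algebraMap B C) 𝔭, Ideal.map_map, hjB, Ideal.map_pow]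
      _ ≤ J' := Ideal.map_mono ((Ideal.pow_right_mono h2 n).trans hJ)
  have hregJ' : Scheme.IsRegular (affineBlowup J') := by
    -- smooth base change `C → B'' ⊗_B C`, then the open piece `C'''`
    haveI : IsOpenImmersion (Spec.map (CommRingCat.ofHom (algebraMap B' B''))) := IsOpenImmersion.of_isLocalization h₀
    haveI : Smooth (Spec.map (CommRingCat.ofHom (algebraMap B B''))) := by
      rw [halgB'', CommRingCat.ofHom_comp, Spec.map_comp]
      infer_instance
    have h1 := BlowupTensorAscent.isRegular_affineBlowup_includeRight_of_smooth (B := B) (B'' := B'') (C := C) J hregJ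
    haveI : IsOpenImmersion (Spec.map (CommRingCat.ofHom (algebraMap C'' C'''))) := IsOpenImmersion.of_isLocalization g
    have h2 := BlowupFlatCriteria.isRegular_affineBlowup_map_of_isOpenImmersion (algebraMap C'' C''') _ h1
    rw [Ideal.map_map] at h2
    exact h2
  -- (6) descend to `B''`
  obtain ⟨I'', hpI'', hI''p, h'', hh'', hregI''⟩ :=
    DescendedPrimaryPiece.exists_descended_primary_piece 𝔔'' 𝔚' hover' hres' hunr' J' h𝔚'J hJ'𝔚 hregJ'
  -- (7) pull back from `D(h₀)` to `B'`
  set I : Ideal B' := I''.comap (algebraMap B' B'') with hI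
  have hII'' : I.map (algebraMap B' B'') = I'' := IsLocalization.map_under (Submonoid.powers h₀) B'' I''
  refine ⟨I, ?_, ?_, ?_⟩
  · refine Ideal.le_comap_of_map_le ?_
    rw [Ideal.map_pow]
    exact hpI''
  · rw [← h𝔔''c]
    exact Ideal.comap_mono hI''p
  · -- `B''_{h''} = B'_{h₀ b}` for `b` with `b/1 ~ h''`
    obtain ⟨b, hb⟩ : ∃ b : B', Associated (algebraMap B' B'' b) h'' :=
      ⟨(IsLocalization.Away.sec h₀ h'').1, IsLocalization.Away.associated_sec_fst h₀ h''⟩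
    have hb𝔔 : b ∉ 𝔔' := by
      intro hb'
      apply hh''
      obtain ⟨u, hu⟩ := hb
      rw [← hu]
      exact Ideal.mul_mem_right _ _ (Ideal.mem_map_of_mem _ hb')
    refine ⟨h₀ * b, fun hmem => (h𝔔'.isPrime.mem_or_mem hmem).elim hh₀ hb𝔔, ?_⟩
    set T := Localization.Away h'' with hT
    haveI : IsLocalization.Away (h₀ * b) T := IsLocalization.Away.mul_of_associated h₀ b h'' hb
    let e : T ≃+* Localization.Away (h₀ * b) :=
      (IsLocalization.algEquiv (Submonoid.powers (h₀ * b)) T (Localization.Away (h₀ * b))).toRingEquiv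
    have hcomp : (e : T →+* Localization.Away (h₀ * b)).comp (algebraMap B' T) = algebraMap B' (Localization.Away (h₀ * b)) := by
      ext x
      exact (IsLocalization.algEquiv (Submonoid.powers (h₀ * b)) T (Localization.Away (h₀ * b))).commutes x
    have h3 : Scheme.IsRegular (affineBlowup (I.map (algebraMap B' T))) := by
      rw [IsScalarTower.algebraMap_eq B' B'' T, ← Ideal.map_map, hII'']
      exact hregI''
    have h4 := BlowupOrbitCentre.isRegular_affineBlowup_map_of_ringEquiv e _ h3
    rw [Ideal.map_map, hcomp] at h4
    exact h4

end Summit.ResolutionOfSingularities.ResolutionOfSingularities.Theorems.FRationalResolution.GaloisUpstairsPiece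

end
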